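import Literature.MathematicalPhysics.QuantumFieldTheory.Balaban1983to89.B12Cubes436
import Literature.Analysis.Calculus.SmoothPlateauProfile

/-!
# `Balaban1983to89.B12ZetaTilde274` — [Balaban1987RG1] p. 274: the smooth cutoff `ζ̃_□` of the near-term
localisation (3.21)–(3.22), CONSTRUCTED («Take a function ζ̃_□ ∈ C₀^∞(□₀), ζ̃_□ = 1 on □̃³, ζ̃_□ = 0 outside □̃⁴»)

HONEST FRAMING (cell `lit-balaban`, verbatim): statement-level skeleton of published theorems with citation tags;
proofs where landed; nothing here is a claim about the Yang–Mills mass gap.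

CITATION HEADER.  T. Bałaban, *Renormalization group approach to lattice gauge field theories. I. Generation of
effective actions in a small field approximation and a coupling constant renormalization in four dimensions*,
Commun. Math. Phys. **109** (1987) 249–301, doi:10.1007/bf01215223 [Balaban1987RG1] (cell paper B12; held text
`paper:balaban1987-cmp109-rg-i-small-field`, journal page = PDF page + 248; the paragraph was read on the page render
`b2b-balaban-ref1/pages/1987-cmp109-rg-I-small-field/…-p026-x2.png` (p. 274), with p. 257 (□̃ⁿ) and p. 273
(□₀ = □̃⁵) on `…-p009-x2.png` / `…-p025-x2.png`).  Unit `lit-balaban-r09` gen 40 (reader/typer of CMP 109, display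
owner), SKELETON row `B12.Def@274` (fold owner r20): before this file the tree carried `ζ̃_□` ONLY through its support
— «supp ζ̃_□ is ANY set S of sites with □̃³ ⊆ S ⊆ □̃⁴ (print fixes one smooth ζ̃_□; only its support enters the sums
of p.290)», «Not typed: the smooth functions ζ_□, ζ̃_□ themselves» (`B12Cubes436`, module docstring) — and as the
multiplication datum `z` of `B12NearTerms321.mulFn` in (3.20)–(3.22).

WHAT IS PRINTED (p. 274 [PDF 26], verbatim).  *«Later it will be important to have the configuration B_□ only,
instead of the expression on the left hand side, so we remove from (3.19) a part of this expression localized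
outside □̃³. Take a function ζ̃_□ ∈ C₀^∞(□₀), ζ̃_□ = 1 on □̃³, ζ̃_□ = 0 outside □̃⁴.»*  With p. 257 [PDF 9]:
*«□̃ⁿ as a cube of the size (1 + 2n)M and with a center at the center of □»* and p. 273 [PDF 25]: *«the cube
□₀ = □̃⁵»*.

WHAT THIS MODULE CONSTRUCTS AND PROVES, in the SITE MODEL of the lineage (`B12Cubes436`, cell DIVERGENCE D-b03.14/33:
the continuum T ↦ ℝᵈ ⊃ ℤᵈ = `Pt d` with the sup distance, □ = a lattice box `Set.Icc a b`, □̃ⁿ = the closed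
sup-neighbourhood `Metric.cthickening (n·R₀) □` of integer collar unit `R₀` (= MN sites for print's □ of §3),
`B12Cubes436.cthickening_box`: □̃ⁿ = `Icc (a − nR₀) (b + nR₀)`).
* `zetaTilde a b R₀ : (Fin d → ℝ) → ℝ` — A CONCRETE CHOICE of print's `ζ̃_□` on the continuum ℝᵈ:
  `ζ̃_□(x) = Π_i f_i(x_i)`, `f_i = Literature.Analysis.Calculus.plateauProfile (a_i − 4R₀) (b_i + 4R₀) R₀`
  (`f_i(t) = S((t − a_i + 4R₀)/R₀)·S((b_i + 4R₀ − t)/R₀)`, `S = Real.smoothTransition`); PROVED: `ζ̃_□ ∈ C^∞(ℝᵈ)`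
  (`contDiff_zetaTilde`), `0 ≤ ζ̃_□ ≤ 1`, **`ζ̃_□ = 1` on the continuum cube `Π_i [a_i − 3R₀, b_i + 3R₀]`** (= □̃³,
  `zetaTilde_eq_one`), **`ζ̃_□ = 0` off the open cube `Π_i ]a_i − 4R₀, b_i + 4R₀[`** (⊆ □̃⁴, `zetaTilde_eq_zero`),
  `tsupport ζ̃_□ ⊆ Π_i [a_i − 4R₀, b_i + 4R₀]` = □̃⁴ ⊂ □̃⁵ = □₀, compact (`tsupport_zetaTilde_subset`,
  `hasCompactSupport_zetaTilde`) — i.e. **`ζ̃_□ ∈ C₀^∞(□₀)`**.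
* `zetaTildeZ a b R x` — its restriction to the sites `x ∈ ℤᵈ` (collar `R₀ = R ∈ ℕ`, as print's `MN`); PROVED for
  `a ≤ b`: `= 1` on □̃³ = `cthickening (3R) (Icc a b)` (`zetaTildeZ_eq_one_of_mem_tilde3`), `= 0` off
  □̃⁴ = `cthickening (4R) (Icc a b)` (`zetaTildeZ_eq_zero_of_not_mem_tilde4`), hence its lattice support
  `suppZ a b R = {x | ζ̃_□(x) ≠ 0}` satisfies **□̃³ ⊆ supp ζ̃_□ ⊆ □̃⁴** (`tilde3_subset_suppZ`, `suppZ_subset_tilde4`)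
  — EXACTLY the two hypotheses `h3`/`h4` under which `B12Cubes436` §4 proved the p. 274 / p. 290 support sentences
  for «any S», now DISCHARGED for the constructed function: `box_subset_suppZ` (□ ⊆ supp ζ̃_□), `suppZ_subset_box0`
  (supp ζ̃_□ ⊆ □₀ = □̃⁵), `compl_suppZ_subset` ((supp ζ̃_□)ᶜ ⊆ (□̃³)ᶜ, p. 290), `finite_suppZ`.
Nothing of the paper is asserted; no `Prop` placeholder, no new fact; axioms standard.  The derivative bounds of
`ζ̃_□` that §4 uses enter rows B12.Eq4.16-4.18 through their own hypotheses and are not restated here.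
-/

namespace Literature.MathematicalPhysics.QuantumFieldTheory.Balaban1983to89.B12ZetaTilde274

open Set Metric Real
open Literature.Analysis.Calculus (plateauProfile contDiff_plateauProfile plateauProfile_nonneg
  plateauProfile_le_one plateauProfile_eq_zero_of_le plateauProfile_eq_zero_of_ge plateauProfile_eq_one
  plateauProfile_pos)
open Literature.MathematicalPhysics.QuantumFieldTheory.Balaban1983to89.B13ScaleTransfer (Pt)
open Literature.MathematicalPhysics.QuantumFieldTheory.Balaban1983to89.B12Cubes436 (cthickening_box mem_box
  box_subset_suppZeta suppZeta_subset_box0 compl_suppZeta_subset finite_suppZeta finite_box)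
open scoped ContDiff

noncomputable section

variable {d : ℕ}

/-! ## 1. `ζ̃_□` on the continuum ℝᵈ -/

/-- **A concrete `ζ̃_□ ∈ C₀^∞(□₀)` of p. 274** for the box □ = `[a, b] ∩ ℤᵈ` with collar unit `R₀`:
`ζ̃_□(x) = Π_i f_i(x_i)` with the one-dimensional plateaus `f_i = plateauProfile (a_i − 4R₀) (b_i + 4R₀) R₀`
(`= 1` on `[a_i − 3R₀, b_i + 3R₀]`, `= 0` off `]a_i − 4R₀, b_i + 4R₀[`, smooth). [cite: Balaban1987RG1, p.274] -/
def zetaTilde (a b : Pt d) (R₀ : ℝ) (x : Fin d → ℝ) : ℝ :=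
  ∏ i, plateauProfile ((a i : ℝ) - 4 * R₀) ((b i : ℝ) + 4 * R₀) R₀ (x i)

/-- `ζ̃_□` unfolded. [cite: Balaban1987RG1, p.274] -/
theorem zetaTilde_apply (a b : Pt d) (R₀ : ℝ) (x : Fin d → ℝ) :
    zetaTilde a b R₀ x = ∏ i, plateauProfile ((a i : ℝ) - 4 * R₀) ((b i : ℝ) + 4 * R₀) R₀ (x i) := rfl

/-- **«ζ̃_□ ∈ C^∞»**: the constructed cutoff is smooth on ℝᵈ. [cite: Balaban1987RG1, p.274] -/
theorem contDiff_zetaTilde (a b : Pt d) (R₀ : ℝ) {n : ℕ∞} : ContDiff ℝ n (zetaTilde a b R₀) := by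
  unfold zetaTilde
  refine contDiff_prod fun i _ => ?_
  exact ((contDiff_plateauProfile _ _ _).of_le (mod_cast le_top)).comp (contDiff_apply ℝ ℝ i)

/-- `0 ≤ ζ̃_□`. [cite: Balaban1987RG1, p.274] -/
theorem zetaTilde_nonneg (a b : Pt d) (R₀ : ℝ) (x : Fin d → ℝ) : 0 ≤ zetaTilde a b R₀ x :=
  Finset.prod_nonneg fun _ _ => plateauProfile_nonneg _ _ _ _

/-- `ζ̃_□ ≤ 1`. [cite: Balaban1987RG1, p.274] -/
theorem zetaTilde_le_one (a b : Pt d) (R₀ : ℝ) (x : Fin d → ℝ) : zetaTilde a b R₀ x ≤ 1 :=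
  Finset.prod_le_one (fun _ _ => plateauProfile_nonneg _ _ _ _) fun _ _ => plateauProfile_le_one _ _ _ _

/-- **«ζ̃_□ = 1 on □̃³»** (continuum form): `ζ̃_□(x) = 1` whenever every coordinate satisfies
`a_i − 3R₀ ≤ x_i ≤ b_i + 3R₀` (`R₀ > 0`). [cite: Balaban1987RG1, p.274] -/
theorem zetaTilde_eq_one {a b : Pt d} {R₀ : ℝ} (hR₀ : 0 < R₀) {x : Fin d → ℝ}
    (hx : ∀ i, (a i : ℝ) - 3 * R₀ ≤ x i ∧ x i ≤ (b i : ℝ) + 3 * R₀) : zetaTilde a b R₀ x = 1 := by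
  unfold zetaTilde
  refine Finset.prod_eq_one fun i _ => plateauProfile_eq_one hR₀ ⟨?_, ?_⟩
  · linarith [(hx i).1]
  · linarith [(hx i).2]

/-- **«ζ̃_□ = 0 outside □̃⁴»** (continuum form): `ζ̃_□(x) = 0` as soon as one coordinate leaves the open interval
`]a_i − 4R₀, b_i + 4R₀[` (`R₀ > 0`). [cite: Balaban1987RG1, p.274] -/
theorem zetaTilde_eq_zero {a b : Pt d} {R₀ : ℝ} (hR₀ : 0 < R₀) {x : Fin d → ℝ} {i : Fin d}
    (hx : x i ≤ (a i : ℝ) - 4 * R₀ ∨ (b i : ℝ) + 4 * R₀ ≤ x i) : zetaTilde a b R₀ x = 0 := by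
  unfold zetaTilde
  refine Finset.prod_eq_zero (Finset.mem_univ i) ?_
  rcases hx with h | h
  · exact plateauProfile_eq_zero_of_le hR₀ h
  · exact plateauProfile_eq_zero_of_ge hR₀ h

/-- `ζ̃_□ > 0` exactly inside the open cube `Π_i ]a_i − 4R₀, b_i + 4R₀[` (`R₀ > 0`): the support of the
constructed cutoff. [cite: Balaban1987RG1, p.274] -/
theorem support_zetaTilde {a b : Pt d} {R₀ : ℝ} (hR₀ : 0 < R₀) :
    Function.support (zetaTilde a b R₀) = {x | ∀ i, x i ∈ Ioo ((a i : ℝ) - 4 * R₀) ((b i : ℝ) + 4 * R₀)} := by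
  ext x
  simp only [Function.mem_support, mem_setOf_eq, mem_Ioo]
  constructor
  · intro h i
    by_contra hc
    rw [not_and_or, not_lt, not_lt] at hc
    exact h (zetaTilde_eq_zero hR₀ hc)
  · intro h
    unfold zetaTilde
    exact (Finset.prod_pos fun i _ => plateauProfile_pos hR₀ (h i)).ne'

/-- **«ζ̃_□ ∈ C₀^∞(□₀)»**, support clause: the closed support of `ζ̃_□` lies in the closed cube
`Π_i [a_i − 4R₀, b_i + 4R₀]` = □̃⁴ ⊂ □̃⁵ = □₀ (`R₀ > 0`). [cite: Balaban1987RG1, p.274] -/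
theorem tsupport_zetaTilde_subset {a b : Pt d} {R₀ : ℝ} (hR₀ : 0 < R₀) :
    tsupport (zetaTilde a b R₀) ⊆ Icc (fun i => (a i : ℝ) - 4 * R₀) (fun i => (b i : ℝ) + 4 * R₀) := by
  refine closure_minimal ?_ isClosed_Icc
  intro x hx
  rw [support_zetaTilde hR₀] at hx
  exact ⟨fun i => (hx i).1.le, fun i => (hx i).2.le⟩

/-- `ζ̃_□` has compact support (a closed subset of a compact cube). [cite: Balaban1987RG1, p.274] -/
theorem hasCompactSupport_zetaTilde {a b : Pt d} {R₀ : ℝ} (hR₀ : 0 < R₀) : HasCompactSupport (zetaTilde a b R₀) :=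
  HasCompactSupport.of_support_subset_isCompact isCompact_Icc
    ((subset_tsupport _).trans (tsupport_zetaTilde_subset hR₀))

/-! ## 2. `ζ̃_□` on the sites of ℤᵈ: `= 1` on □̃³, `= 0` off □̃⁴, □̃³ ⊆ supp ζ̃_□ ⊆ □̃⁴ -/

/-- The lattice restriction of the constructed `ζ̃_□` (integer collar unit `R`, print's `R₀ = MN`).
[cite: Balaban1987RG1, p.274] -/
def zetaTildeZ (a b : Pt d) (R : ℕ) (x : Pt d) : ℝ := zetaTilde a b R (fun i => (x i : ℝ))

/-- `0 ≤ ζ̃_□(x) ≤ 1` at every site. [cite: Balaban1987RG1, p.274] -/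
theorem zetaTildeZ_mem_Icc (a b : Pt d) (R : ℕ) (x : Pt d) : zetaTildeZ a b R x ∈ Icc (0 : ℝ) 1 :=
  ⟨zetaTilde_nonneg _ _ _ _, zetaTilde_le_one _ _ _ _⟩

/-- **«ζ̃_□ = 1 on □̃³»** on the lattice: for the box □ = `Icc a b` (`a ≤ b`) and every site of
□̃³ = `cthickening (3R) □` (= `Icc (a − 3R) (b + 3R)`, `B12Cubes436.cthickening_box`), `ζ̃_□(x) = 1` (`R ≥ 1`).
[cite: Balaban1987RG1, p.274] -/
theorem zetaTildeZ_eq_one_of_mem_tilde3 {a b : Pt d} (hab : a ≤ b) {R : ℕ} (hR : 1 ≤ R) {x : Pt d}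
    (hx : x ∈ cthickening ((3 * R : ℕ) : ℝ) (Icc a b)) : zetaTildeZ a b R x = 1 := by
  rw [cthickening_box hab, mem_box] at hx
  have hR₀ : (0 : ℝ) < R := by exact_mod_cast hR
  refine zetaTilde_eq_one hR₀ fun i => ?_
  obtain ⟨h1, h2⟩ := hx i
  simp only [Pi.sub_apply, Pi.add_apply, Pi.natCast_apply] at h1 h2
  push_cast at h1 h2
  constructor
  · have : ((a i - 3 * R : ℤ) : ℝ) ≤ (x i : ℝ) := by exact_mod_cast h1
    push_cast at this
    linarith
  · have : (x i : ℝ) ≤ ((b i + 3 * R : ℤ) : ℝ) := by exact_mod_cast h2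
    push_cast at this
    linarith

/-- **«ζ̃_□ = 0 outside □̃⁴»** on the lattice: for the box □ = `Icc a b` (`a ≤ b`) and every site OUTSIDE
□̃⁴ = `cthickening (4R) □` (= `Icc (a − 4R) (b + 4R)`), `ζ̃_□(x) = 0` (`R ≥ 1`). [cite: Balaban1987RG1, p.274] -/
theorem zetaTildeZ_eq_zero_of_not_mem_tilde4 {a b : Pt d} (hab : a ≤ b) {R : ℕ} (hR : 1 ≤ R) {x : Pt d}
    (hx : x ∉ cthickening ((4 * R : ℕ) : ℝ) (Icc a b)) : zetaTildeZ a b R x = 0 := by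
  rw [cthickening_box hab, mem_box, not_forall] at hx
  obtain ⟨i, hi⟩ := hx
  have hR₀ : (0 : ℝ) < R := by exact_mod_cast hR
  rw [not_and_or, not_le, not_le] at hi
  simp only [Pi.sub_apply, Pi.add_apply, Pi.natCast_apply] at hi
  push_cast at hi
  refine zetaTilde_eq_zero hR₀ (i := i) ?_
  rcases hi with h | h
  · left
    have h' : x i ≤ a i - 4 * R := by omega
    have : (x i : ℝ) ≤ ((a i - 4 * R : ℤ) : ℝ) := by exact_mod_cast h'
    push_cast at this
    linarith
  · right
    have h' : b i + 4 * R ≤ x i := by omega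
    have : ((b i + 4 * R : ℤ) : ℝ) ≤ (x i : ℝ) := by exact_mod_cast h'
    push_cast at this
    linarith

/-- **supp ζ̃_□ ∩ ℤᵈ** for the constructed cutoff: the sites where `ζ̃_□ ≠ 0`. [cite: Balaban1987RG1, p.274] -/
def suppZ (a b : Pt d) (R : ℕ) : Set (Pt d) := {x | zetaTildeZ a b R x ≠ 0}

/-- **□̃³ ⊆ supp ζ̃_□** — hypothesis `h3` of `B12Cubes436` §4, DISCHARGED for the constructed `ζ̃_□`.
[cite: Balaban1987RG1, p.274] -/
theorem tilde3_subset_suppZ {a b : Pt d} (hab : a ≤ b) {R : ℕ} (hR : 1 ≤ R) :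
    cthickening (3 * (R : ℝ)) (Icc a b) ⊆ suppZ a b R := by
  intro x hx
  have h1 : zetaTildeZ a b R x = 1 :=
    zetaTildeZ_eq_one_of_mem_tilde3 hab hR (by simpa only [Nat.cast_mul, Nat.cast_ofNat] using hx)
  simp only [suppZ, mem_setOf_eq, h1]
  exact one_ne_zero

/-- **supp ζ̃_□ ⊆ □̃⁴** — hypothesis `h4` of `B12Cubes436` §4, DISCHARGED for the constructed `ζ̃_□`.
[cite: Balaban1987RG1, p.274] -/
theorem suppZ_subset_tilde4 {a b : Pt d} (hab : a ≤ b) {R : ℕ} (hR : 1 ≤ R) :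
    suppZ a b R ⊆ cthickening (4 * (R : ℝ)) (Icc a b) := by
  intro x hx
  by_contra hc
  have h0 : zetaTildeZ a b R x = 0 :=
    zetaTildeZ_eq_zero_of_not_mem_tilde4 hab hR (by simpa only [Nat.cast_mul, Nat.cast_ofNat] using hc)
  exact hx h0

/-- **«supp δB ⊂ □ … supp B ⊂ supp ζ̃_□»** (p. 290) for the constructed cutoff: □ ⊆ supp ζ̃_□
(`B12Cubes436.box_subset_suppZeta` instantiated). [cite: Balaban1987RG1, p.290] -/
theorem box_subset_suppZ {a b : Pt d} (hab : a ≤ b) {R : ℕ} (hR : 1 ≤ R) : Icc a b ⊆ suppZ a b R :=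
  box_subset_suppZeta (tilde3_subset_suppZ hab hR)

/-- **«ζ̃_□ ∈ C₀^∞(□₀)»** on the lattice: supp ζ̃_□ ⊆ □̃⁵ = □₀ (`B12Cubes436.suppZeta_subset_box0` instantiated).
[cite: Balaban1987RG1, p.273 and p.274] -/
theorem suppZ_subset_box0 {a b : Pt d} (hab : a ≤ b) {R : ℕ} (hR : 1 ≤ R) :
    suppZ a b R ⊆ cthickening (5 * (R : ℝ)) (Icc a b) :=
  suppZeta_subset_box0 (Nat.cast_nonneg R) (suppZ_subset_tilde4 hab hR)

/-- **«a sum over a subset of (□̃³)ᶜ∩Z⁴»** (p. 290) for the constructed cutoff: (supp ζ̃_□)ᶜ ⊆ (□̃³)ᶜ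
(`B12Cubes436.compl_suppZeta_subset` instantiated). [cite: Balaban1987RG1, p.290] -/
theorem compl_suppZ_subset {a b : Pt d} (hab : a ≤ b) {R : ℕ} (hR : 1 ≤ R) :
    (suppZ a b R)ᶜ ⊆ (cthickening (3 * (R : ℝ)) (Icc a b))ᶜ :=
  compl_suppZeta_subset (tilde3_subset_suppZ hab hR)

/-- supp ζ̃_□ ∩ ℤᵈ is a finite set of sites (`B12Cubes436.finite_suppZeta` instantiated). [cite: Balaban1987RG1, p.274] -/
theorem finite_suppZ {a b : Pt d} (hab : a ≤ b) {R : ℕ} (hR : 1 ≤ R) : (suppZ a b R).Finite :=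
  finite_suppZeta (finite_box a b) (Nat.cast_nonneg R) (suppZ_subset_tilde4 hab hR)

end

end Literature.MathematicalPhysics.QuantumFieldTheory.Balaban1983to89.B12ZetaTilde274
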